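import Mathlib
import Summits.Parity.GeneralizedHardyLittlewood.Theses.LiouvilleMAD

/-!
# Sketch — crux-ideate round 1, ideator 1, crux `DilatedChowla` (stmt-Parity-13319)

Elementary statements referred to in the ideator report (`ideator1-report.md`).  Nothing here is an
idea card; these are the checkable identities / floors / consequences that every line on this crux
meets.  `S c n n' M := Σ_{m ∈ (M,2M]} λ(mn+c) λ(mn'+c)` is the crux's pencil sum.
-/

namespace Summit.Parity.GeneralizedHardyLittlewood.Cruxes.DilatedChowla.Ideator1

open Finset

/-- Liouville at an integer argument, the crux's `Int.toNat` convention (`λ 0 = 0`). -/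
noncomputable def lam (z : ℤ) : ℝ := (ArithmeticFunction.liouville (Int.toNat z) : ℝ)

/-- The pencil sum of the crux. -/
noncomputable def S (c : ℤ) (n n' M : ℕ) : ℝ :=
  ∑ m ∈ Ioc M (2 * M), lam ((m : ℤ) * n + c) * lam ((m : ℤ) * n' + c)

/-- READ-BACK: the crux is the uniform power bound on `S`. -/
theorem dilatedChowla_iff :
    Theses.LiouvilleMAD.DilatedChowla ↔
      ∀ c : ℤ, c ≠ 0 → ∃ κ : ℝ, 0 < κ ∧ ∃ C : ℝ, ∀ M n n' : ℕ, 1 ≤ n → 1 ≤ n' → n ≠ n' →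
        n ≤ 2 * M → n' ≤ 2 * M → |S c n n' M| ≤ C * (M : ℝ) ^ (1 - κ) := Iff.rfl

/-- (1) SUB-PROGRESSION SELF-SIMILARITY (exact): restricting the parameter `m` to the multiples of
`d` at scale `d·M₀` is the pencil sum at scale `M₀` with both dilations multiplied by `d`.  The
family of instances is closed under `(M, n, n') ↦ (M/d, dn, dn')`; it is the only exact symmetry
with the shift `c` fixed (the other one, `λ(d(mn+c)) = λ(m(dn)+dc)`, moves `c`). -/
theorem subprogression_identity (f : ℤ → ℝ) (c : ℤ) (d M₀ n n' : ℕ) (hd : 1 ≤ d) :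
    ∑ m ∈ (Ioc (d * M₀) (2 * (d * M₀))).filter (fun m : ℕ => d ∣ m),
        f ((m : ℤ) * n + c) * f ((m : ℤ) * n' + c)
      = ∑ m₀ ∈ Ioc M₀ (2 * M₀), f ((m₀ : ℤ) * (d * n) + c) * f ((m₀ : ℤ) * (d * n') + c) := by
  sorry

/-- (2) WELCH / RANK FLOOR (tightness): the `2M` columns `(λ(mn+c))_{m ∈ (M,2M]}`, `n ≤ 2M`, are
`±1` vectors of squared norm `M` in `ℝ^M` once `M > |c|`, so some off-diagonal Gram entry is at
least `√(M/2)` in absolute value (Welch bound for `K = 2M > M` vectors; equivalently the Gram matrix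
has rank `≤ M`, forcing `Σ_{n≠n'} S² ≥ M³`).  Hence no exponent `κ > 1/2` is possible in the crux;
the random model predicts `max |S| ≍ √(M log M)`, i.e. `κ = 1/2 − o(1)`. -/
def WelchFloor : Prop :=
  ∀ c : ℤ, ∀ M : ℕ, (|c| : ℝ) < M →
    ∃ n n' : ℕ, 1 ≤ n ∧ 1 ≤ n' ∧ n ≠ n' ∧ n ≤ 2 * M ∧ n' ≤ 2 * M ∧
      Real.sqrt ((M : ℝ) / 2) ≤ |S c n n' M|

/-- Consequence of (2): the crux with `κ > 1/2` is false (for the disprover; elementary). -/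
theorem no_exponent_above_half (hW : WelchFloor) :
    ¬ (∀ c : ℤ, c ≠ 0 → ∃ κ : ℝ, 1 / 2 < κ ∧ ∃ C : ℝ, ∀ M n n' : ℕ, 1 ≤ n → 1 ≤ n' → n ≠ n' →
        n ≤ 2 * M → n' ≤ 2 * M → |S c n n' M| ≤ C * (M : ℝ) ^ (1 - κ)) := by
  sorry

/-- (3) DISPERSION CONSEQUENCE (Linnik's identity `Σ_m (Σ_n T_{mn})² = Σ_{n,n'} S(n,n')`): the crux
forces a POWER-saving Barban–Davenport–Halberstam bound for `λ` in the single class `c mod m`, on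
average over moduli `m ≍ √x` with segments of length `≍ √x` (`x = 4M²`) — a statement on which GRH
is silent (GRH's `x^{1/2+ε}` exceeds the segment length).  Random size of the left side: `2M²`. -/
def PowerDispersion : Prop :=
  ∀ c : ℤ, c ≠ 0 → ∃ κ : ℝ, 0 < κ ∧ ∃ C : ℝ, ∀ M : ℕ,
    ∑ m ∈ Ioc M (2 * M), (∑ n ∈ Icc 1 (2 * M), lam ((m : ℤ) * n + c)) ^ 2
      ≤ 2 * (M : ℝ) ^ 2 + C * (M : ℝ) ^ (3 - κ)

theorem powerDispersion_of_dilatedChowla (h : Theses.LiouvilleMAD.DilatedChowla) :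
    PowerDispersion := by
  sorry

/-- (4) RAY FORM (alignment by complete multiplicativity): for `n ∣`-bookkeeping-free statement we
record only the value identity used: `λ((kn' + c(n−n'))/n)·λ(n) = λ(kn' + c(n−n'))` whenever
`n ∣ kn' + c(n − n')` and the argument is positive — so `λ(n)·S(n,n';M)` is the two-point sum of
`λ(k)λ(n'k + h)`, `h = c(n−n')`, over `k ≡ c (mod n)`, `k ∈ (Mn, 2Mn]`: a progression-restricted
dilated pair at height `≍ Mn` with `M` of its `Mn` terms (square-root sparse when `n ≍ M`). -/
theorem lam_div_mul (x : ℤ) (n : ℕ) (hn : 1 ≤ n) (hx : 0 < x) (hdiv : (n : ℤ) ∣ x) :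
    lam (x / n) * lam n = lam x := by
  sorry

/-- (5) PRETENDER CLASS (heuristic → to be made a theorem by the disprover): for dilations
`n' ≍ M` most values `b = n'm + c ≍ M²` have largest prime factor `> M`, each such prime dividing at
most two values `b`; flipping the sign of a completely multiplicative `f` at primes `> M^{1+ε}`
therefore steers `Σ_m f((nm+c)(n'm+c))` term by term.  CLAIM: for every `ε > 0` and large `M`
there is a completely multiplicative `f : ℕ → {±1}` with `f p = -1` for all primes `p ≤ M^{1+ε}`
and `|Σ_{m∈(M,2M]} f((m+c)((2M)m+c))| ≥ M/(C log M)`.  Any proof of the crux must therefore use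
`λ(p) = −1` at primes ABOVE the length of the sum (for `n,n' = O(1)`: above `M^{1−2κ}`). -/
def PretenderFailure : Prop :=
  ∀ c : ℤ, c ≠ 0 → ∀ ε : ℝ, 0 < ε → ∃ C : ℝ, 0 < C ∧ ∃ M₀ : ℕ, ∀ M : ℕ, M₀ ≤ M →
    ∃ f : ℕ → ℝ, (∀ a b, f (a * b) = f a * f b) ∧ (∀ k, 1 ≤ k → f k = 1 ∨ f k = -1) ∧
      (∀ p : ℕ, p.Prime → (p : ℝ) ≤ (M : ℝ) ^ (1 + ε) → f p = -1) ∧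
      (M : ℝ) / (C * Real.log M) ≤
        |∑ m ∈ Ioc M (2 * M), f (Int.toNat ((m : ℤ) + c)) * f (Int.toNat ((m : ℤ) * (2 * M) + c))|

end Summit.Parity.GeneralizedHardyLittlewood.Cruxes.DilatedChowla.Ideator1
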